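import Summits.HodgeConjecture.HodgeConjecture.Theorems.HeckePrymWeilWeilSixfoldsSqrtMinus7AimedPartnerOfParts
import Summits.HodgeConjecture.HodgeConjecture.Theorems.HeckePrymWeilWeilSixfoldsSqrtMinus7OfAimedPartner
import Summits.HodgeConjecture.HodgeConjecture.Theorems.HeckePrymWeilWeilSixfoldsSqrtMinus7CmCurveSeven
import Summits.HodgeConjecture.HodgeConjecture.Theorems.HeckePrymWeilWeilSixfoldsSqrtMinus7HodgeRiemannOne
import Summits.HodgeConjecture.HodgeConjecture.Theorems.HeckePrymWeilWeilSixfoldsSqrtMinus7HyperplaneCalculusSym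
import Summits.HodgeConjecture.HodgeConjecture.Theorems.HeckePrymWeilWeilSixfoldsSqrtMinus7WeilSignatureOf
import HarnessLib

/-!
# Crux `WeilSixfoldsSqrtMinus7` (stmt-HodgeConjecture-1260), line `hyperbolic-eightfold-descent` — Stub 7 (the AIMED PARTNER at `d = 7`) PROVED; the crux from the split eightfold crux ALONE

Route `HeckePrymWeil`. Final assembly of the line: every registered sub-goal of Stub 7 has landed —
G1 `stub_cmCurveSeven` (the CM curve `ℂ/(ℤ + ℤ·i√7)` with `[i√7]`, from the sibling line's
`exists_cmCurveModel`), G2a `stub_cmSurfaceModel`, G2b `stub_cmDescentPair`, G3 `stub_weilSignature_of`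
(signature `(n, n)` of the rational model of a Weil-type `(A, φ, h_A)` modulo Hodge–Riemann in degree
one for the `K`-symmetrised class), HR₁ `stub_hodgeRiemannOne` (Hodge–Riemann in degree one for the
hyperplane class, the tree's `hodgeRiemann_degreeOne_of_isOfHodgeType`), G4′ `stub_hyperplaneCalculusSym`
(hyperplane classes on `complexBetti`: Segre, Veronese, spanning, `φ`-twisted re-embedding) — so the
assembly `aimedPartnerSeven_of_parts` (file `…AimedPartnerOfParts`) yields:

* `stub_aimedPartnerSeven` — **the AIMED PARTNER at `d = 7`, unconditionally** (the registered stub S7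
  of the line's skeleton, verbatim): for every `n ≥ 1` and every complex abelian `2n`-fold `(A, φ)`
  with `φ ≫ φ = -7` carrying a non-zero rational `(n,n)`-class in its Weil plane, the CM Weil surface
  `B = E × E`, `ψ = (ι, -ι)`, with its descent pair and a projective embedding of `A × B` for whose
  `K`-symmetrised hyperplane class `(A × B, φ × ψ)` is of HYPERBOLIC Weil type in half-dimension
  `n + 1` (B. van Geemen, LNM 1594 (1994), Lemma 5.2, 5.3, 5.4; E. Markman, arXiv:2509.23403 §11.5
  Step 2; C. Schoen, Compositio 114 (1998) §10).
* `weilSixfoldsSqrtMinus7_of_hyperbolicEightfoldsSqrtMinus7` — **the crux from the split eightfold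
  crux ALONE**: `HyperbolicEightfoldsSqrtMinus7 → WeilSixfoldsSqrtMinus7` (the landed composition
  `weilSixfoldsSqrtMinus7_of_hyperbolicEightfolds_of_aimedPartnerSeven` fed S7). In words: the
  Hodge–Weil classes of EVERY `ℚ(√-7)`-Weil abelian sixfold, of EVERY discriminant, are algebraic as
  soon as they are on the split (hyperbolic) `ℚ(√-7)`-Weil EIGHTFOLDS — Schoen/van Geemen/Markman's
  product trick one genus up, kernel-checked on the real carriers with no named fact.

What stays open: `HyperbolicEightfoldsSqrtMinus7` (item stmt-HodgeConjecture-14642), Markman's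
Question 8.2.4 at `d = 7` — open mathematics.
-/

noncomputable section

-- every declaration of this problem lives in `Summit.HodgeConjecture.HodgeConjecture.…`
set_option linter.dupNamespace false

open CategoryTheory
open Literature.AlgebraicGeometry Literature.AlgebraicGeometry.Motives
  Literature.AlgebraicGeometry.HodgeTheory Literature.AlgebraicTopology.SingularHomology
  Literature.Geometry.Kaehler
open Summit.HodgeConjecture.HodgeConjecture.Theses.HeckePrymWeil

namespace Summit.HodgeConjecture.HodgeConjecture.Theorems.WeilSixfoldsSqrtMinus7.HyperbolicEightfoldDescent

/-- **Stub 7 of line `hyperbolic-eightfold-descent` — the AIMED PARTNER at `d = 7` — PROVED**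
(registered stub `stub_aimedPartnerSeven`, verbatim): `aimedPartnerSeven_of_parts` fed with the landed
G1, G3 (= `stub_weilSignature_of` fed `hodgeRiemannOne_symmetrised stub_hodgeRiemannOne
stub_hyperplaneCalculusSym`) and G4′. [cite: vanGeemen1994HodgeAV, Lemma 5.2 (2)–(3), 5.3 and 5.4 (5.4.1)]
[cite: Markman2025SurveySecant, §11.5 Step 2] [cite: Schoen1998HodgeWeilAddendum, §10] -/
theorem stub_aimedPartnerSeven :
    ∀ (n : ℕ) (A : AbelianVariety ℂ) (φ : A ⟶ A), 1 ≤ n → A.dim = 2 * n → φ ≫ φ = -((7 : ℤ) • 𝟙 A) →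
      (∃ c : complexBetti A.X (2 * n), c ≠ 0 ∧ IsRationalClass c ∧
        IsOfHodgeType (2 * n) A.X (2 * n) n n c ∧
        c ∈ Module.End.eigenspace (complexBetti.map (𝟙 A + φ).hom.hom.hom (2 * n)).hom
              ((1 + Complex.I * (Real.sqrt (7 : ℝ) : ℂ)) ^ (2 * n)) ⊔
            Module.End.eigenspace (complexBetti.map (𝟙 A + φ).hom.hom.hom (2 * n)).hom
              ((1 - Complex.I * (Real.sqrt (7 : ℝ) : ℂ)) ^ (2 * n))) →
      ∃ (B : AbelianVariety ℂ) (ψ : B ⟶ B), B.dim = 2 ∧ ψ ≫ ψ = -((7 : ℤ) • 𝟙 B) ∧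
        (∃ bp bm η : complexBetti B.X 2,
          bp ∈ Module.End.eigenspace (complexBetti.map (𝟙 B + ψ).hom.hom.hom 2).hom
                ((1 + Complex.I * (Real.sqrt (7 : ℝ) : ℂ)) ^ 2) ∧
          bm ∈ Module.End.eigenspace (complexBetti.map (𝟙 B + ψ).hom.hom.hom 2).hom
                ((1 - Complex.I * (Real.sqrt (7 : ℝ) : ℂ)) ^ 2) ∧
          IsRationalClass (bp + bm) ∧ IsOfHodgeType 2 B.X 2 1 1 (bp + bm) ∧
          η ∈ algebraicClasses B.X 1 ∧
          cupProduct (show 2 + 2 = 4 from rfl) bp η ≠ 0 ∧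
          cupProduct (show 2 + 2 = 4 from rfl) bm η ≠ 0) ∧
        ∃ (e : ProjectiveEmbedding (A.prod B).X) (a : complexBetti (projectiveSpace e.n ℂ) 2),
          IsRationalClass a ∧ a ≠ 0 ∧
          IsHyperbolicWeilType (A.prod B)
            (AbelianVariety.prodLift (AbelianVariety.fst A B ≫ φ) (AbelianVariety.snd A B ≫ ψ))
            (n + 1)
            ((7 : ℂ) • complexBetti.map e.ι 2 a +
              complexBetti.map (AbelianVariety.prodLift (AbelianVariety.fst A B ≫ φ)
                (AbelianVariety.snd A B ≫ ψ)).hom.hom.hom 2 (complexBetti.map e.ι 2 a)) :=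
  aimedPartnerSeven_of_parts stub_cmCurveSeven
    (stub_weilSignature_of (hodgeRiemannOne_symmetrised stub_hodgeRiemannOne stub_hyperplaneCalculusSym))
    stub_hyperplaneCalculusSym

/-- **The crux from the split eightfold crux alone**: `HyperbolicEightfoldsSqrtMinus7 →
WeilSixfoldsSqrtMinus7` — every `ℚ(√-7)` sixfold discriminant from the split `ℚ(√-7)` eightfolds
(the glue `EightfoldDescentGlue` with the lever `AimedDescending (7, 3)` DISCHARGED: the landed
`weilSixfoldsSqrtMinus7_of_hyperbolicEightfolds_of_aimedPartnerSeven` fed `stub_aimedPartnerSeven`).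
[cite: Markman2025SurveySecant, §11.5 Step 2] [cite: Schoen1998HodgeWeilAddendum, §10] -/
theorem weilSixfoldsSqrtMinus7_of_hyperbolicEightfoldsSqrtMinus7 :
    HyperbolicEightfoldsSqrtMinus7 → WeilSixfoldsSqrtMinus7 :=
  weilSixfoldsSqrtMinus7_of_hyperbolicEightfolds_of_aimedPartnerSeven stub_aimedPartnerSeven

end Summit.HodgeConjecture.HodgeConjecture.Theorems.WeilSixfoldsSqrtMinus7.HyperbolicEightfoldDescent

end
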